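/-
COR-CM (cells pub-hodgecm / pub-hodgecm2, stage 2 of the Hodge ladder) — TRANSPOSITION SURGE, item (vi) sub-binder S2 / (vi-2)
`supply`, PINNING RECORD, REACH HALF: TEAM hComp row **U2a, sequel — the TOTAL instance `Model.honestP5Of` (I-TOT)** of the
honest Prop-C.5 datum (`HComp/HonestP5.lean`) at the CHOSEN canonical-model system of the tree's hermitian space
(`Model.recordAt`, hcomp-shimura's `HComp/RecordCarriers.lean`, row U1d) below Liu's threshold `K_f(3)` (`HComp.K3`, hcomp-level's
`HComp/Levels.lean`, row U2c); hcomp-lead design point S6 («I-TOT without dependent rewriting», HOME/INBOX l.5138) with the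
case split placed INSIDE THE FUNCTOR (b25, l.5232); hcomp-ref R-5 (the else-branch keeps the consumer's carrier type inhabitable at
`[F:ℚ] = 2`).  Seat prover-pub-hodgecm2-b25-g38-0 (acting writer of row U2a; HCOMP-TABLE.md v1.1).  DEFINITIONS + unfolding lemmas;
the ONLY hypothesis binder is the named fact `h : UnitaryCanonicalModel.exists_recordSystem` ([Deligne1979] 2.2.5 / Cor. 2.7.21,
x1's `Literature/AlgebraicGeometry/ShimuraVarieties/UnitaryShimuraCanonicalModel.lean`), under which everything is stated (T5: n/a,
one binder).  Nothing in the tree is edited or restated.  FRAMING: HC_CM is NOT proved; S2 is NOT closed; a SUB-OBJECT, not a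
discharge.
-/
import Summits.HodgeConjecture.CorCM.B01.Transposition.HComp.HonestP5
import Summits.HodgeConjecture.CorCM.B01.Transposition.HComp.RecordCarriers
import Summits.HodgeConjecture.CorCM.B01.Transposition.HComp.Levels
import Mathlib.AlgebraicGeometry.ProjectiveSpectrum.Basic
import Mathlib.RingTheory.MvPolynomial.Homogeneous
import HarnessLib

/-!
# TEAM hComp (U2a, I-TOT): `Model.honestP5Of h : ∀ F ι₁ V Φ, PropC5Data F⁺ F` — the honest datum at the chosen record

Pin-1's `Model.hComp_of_unif_of_alb_along` quantifies its carrier UNGUARDED: `P5 : ∀ (F : CMField) (ι₁ : F →+* ℂ) (V : HermSpace3 F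
ι₁) (Φ : CMType F), PropC5Data (maximalRealSubfield F) F`, while Deligne's canonical-model system for the tree's `V` is available
(from the named fact `h : exists_recordSystem`) only when `V.Hm` is anisotropic, i.e. for `4 ≤ [F:ℚ]` (`HermSpace3.anisotropic_of_four_le`;
every hComp READ of `P5` sits under the face guard `6 ≤ [F:ℚ]`).  Following hcomp-lead's S6, ALL data fields of the instance are
UNIFORM in `F` — `n := 3`, `G := Gτ τ := ↥V.adelicFin`, `fix τ := refl`, the tokens, AND the slot formula
`Sh τ τ' := restrictFunctor (K3 V) ⋙ conjSystem V (K3 V) M ⋙ C5.baseChangeAlong τ'.rangeRestrictField` of `HonestP5.lean` — and the one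
case split sits inside the FUNCTOR `M := Model.recordFunctorOf h V`:

* `4 ≤ [F:ℚ]`: `M := (Model.recordOf h V h4).M`, THE chosen system `Model.recordOf h V h4 := Model.recordAt h V h4 (K3 V) (…K3 torsion-free…)`
  (one named term: the same `Classical.choice` wherever written — here and in pin-1's U5; hcomp-ref R-5);
* else (`[F:ℚ] = 2`, never read by any hComp theorem): the constant system at the PUNCTURED PROJECTIVE PLANE `ℙ²_F ∖ {[0:0:1]}` — a
  smooth surface, NOT proper, compactified by `ℙ²` with ONE boundary point, which is what [Liu2021] §4.2 l. 2055–2064 / l. 4656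
  prescribes for `d = 1`, `n = 3` (Noncompact Case: `Sh(𝕍)_K` non-projective, `X_K = S̃h(𝕍)_K` projective, finitely many boundary
  points), so that the consumer's posited carrier type `Sec42Data (honestP5Of h F ι₁ V Φ) iso` (Glue.lean :353: `isProjectiveOver_Sh_iff`
  AND `CompactifiedSystem`'s discrete boundary :306) stays inhabitable in principle at `d = 1` — hcomp-lead RULING F1′ (HOME/INBOX
  l.5453) on pin-1's finding (l.5442, Goodman: an AFFINE slot admits no such compactification), hcomp-ref R-5: no vacuity enters through
  the unguarded data binders `C`, `R`.  Honest by unconsumption at `d = 1` (`hComp`/`hUnif` quantify `6 ≤ [F:ℚ]`).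

Hence `(honestP5Of h F ι₁ V Φ).G` is `↥V.adelicFin` BY `rfl` for every `F` (pin-1's `K : C5.OpenCompactSubgroup (P5 F ι₁ V Φ).G` never
changes type; `Ksm := (K3 V).1` types without a cast), every lemma of `HonestP5.lean` applies verbatim at `M := recordFunctorOf h V`
(`honestSystemOf`, `propC5AsPrinted_honestP5Of`), and the single consumed rewriting lemma is the OBJECT-LEVEL (non-dependent)
`recordFunctorOf_objIso h4 K : (recordFunctorOf h V).obj K ≅ (recordOf h V h4).M.obj K` (`eqToIso ∘ dif_pos`): pin-1's slot isomorphism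
at P2′ is `honestP5Of_slotIsoConj h4 : (…slot (τ, ῑ₁) at K…) ⊗ ℂ ≅ M_K ⊗_{F,ι₁} ℂ` with `M_K := (recordOf h V h4).M.obj ⟨K, hK⟩`, and
`honestP5Of_exists_isColimit_cofan h4` moves the record's `pieces` cofan onto the slot apex in one call (U5's last steps).
§3: the compactified system of Def. C.8 (Compact Case, «`S̃h(𝕍)_K = Sh(𝕍)_K`», l. 4656) at ANY record system `S`, HYPOTHESIS-FREE from
the record's (F1) fields `S.smooth`, `S.projective` (`Model.recordCompactified S : CompactifiedSystem (honestSystem V K₀ S.M)`).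

T5: n/a (one binder `h`; no theorem with ≥ 2 Prop hypothesis binders).  HC_CM is NOT proved.

References: [Liu2021] App. C l. 4550, l. 4618–4624, Prop. C.5 l. 4627–4633, Def. C.6, l. 4656, Def. C.8, §4.2 l. 2053–2066, Thm. 4.18 (1)
l. 2239; [Deligne1979] 2.1.2, 2.2.5, Cor. 2.7.21; [Milne2005] (21), Thm. 2.14; Görtz–Wedhorn I Prop. 4.16; Q. Liu (2002) Prop. 3.1.23 / 4.3.38.
-/

noncomputable section

namespace Summit.HodgeConjecture.CorCM.Model

open CategoryTheory CategoryTheory.Limits AlgebraicGeometry NumberField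
open Literature.AlgebraicGeometry.Motives
open Literature.AlgebraicGeometry.ShimuraVarieties
open Literature.AlgebraicGeometry.ShimuraVarieties.UnitaryCanonicalModel
open Literature.NumberTheory.Automorphic
open Literature.NumberTheory.Automorphic.Liu2021.AppendixC
open Literature.Geometry.ComplexHyperbolic
open Summit.HodgeConjecture.CorCM.HComp

/-! ## §1  The chosen system below `K_f(3)` and the total record functor -/

section RecordFunctor

variable {F : CMField} {ι₁ : F →+* ℂ}

/-- **THE chosen canonical-model system of the tree's `V` below Liu's threshold `K_f(3)`** (one named term): hcomp-shimura's
`Model.recordAt h V h4 K₀ htf` at `K₀ := K3 V` with hcomp-level's torsion-freeness of the conjugate arithmetic levels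
`Γ_{V.Hm}(gKg⁻¹)`, `K ≤ K_f(3)` ([Liu2021] l. 4599 «neat», l. 4627 «sufficiently small»; Minkowski) — the projective system `K ↦ M_K`,
`K ≤ K_f(3)`, of Deligne's models over `F` (along `ι₁`) of `Sh(Res_{F⁺/ℚ} U(V), 𝔹²)_K` on the TAUTOLOGICAL ball of `V.Hm^{ι₁}` (datum
`h_{V,ῑ₁}`), from the named fact `h : exists_recordSystem` ([Deligne1979] 2.2.5, Cor. 2.7.21).  CONDITIONAL on `h`; HC_CM is NOT proved.
[cite: Deligne1979ShimuraVarieties, 2.2.5 and Cor. 2.7.21] [cite: Liu2021, App. C l. 4599 and Prop. C.5 l. 4627–4628] -/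
abbrev recordOf (h : exists_recordSystem) (V : HermSpace3 F ι₁) (h4 : 4 ≤ Module.finrank ℚ F) :
    RecordSystem F V.Hm ι₁ (frameOf V) (formCongr_frameOf V) (K3 V) :=
  recordAt h V h4 (K3 V) (torsionFree_arithmeticLevel_conj_K3 V)

variable (F) in
/-- The punctured projective plane `ℙ²_F ∖ {[0:0:1]} = D₊(x₀) ∪ D₊(x₁) ⊂ Proj F[x₀,x₁,x₂]` over `F` (the open of the tree's
`projectiveSpace 2 F`, with its structure map): a smooth surface, NOT proper, whose smooth projective compactification `ℙ²` adds ONE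
closed point — exactly the shape [Liu2021] §4.2 l. 2055–2064 / App. C l. 4656 prescribes in the Noncompact Case (`d = 1`, `n = 3`:
`Sh(𝕍)_K` smooth quasi-projective non-projective, `X_K = S̃h(𝕍)_K` projective with finitely many boundary points).  Used ONLY as the
never-read else-branch of `recordFunctorOf` (hcomp-lead RULING F1′, pin-1's Goodman argument, hcomp-ref R-5: with it the consumer's
carrier type `Sec42Data (honestP5Of h F ι₁ V Φ) iso` — `CompactifiedSystem` included — stays inhabitable in principle at `[F:ℚ] = 2`,
by `X_K := \overline{Sh} := ℙ²`, `j = jBar` the open immersion, boundary one point; an AFFINE else-slot would make it empty).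
[cite: Liu2021, §4.2 l. 2053–2064 and App. C l. 4656] -/
def puncturedPlane : SchemeOver F :=
  letI := MvPolynomial.gradedAlgebra (σ := Fin 3) (R := (F : Type))
  Over.mk ((Proj.basicOpen (MvPolynomial.homogeneousSubmodule (Fin 3) F) (MvPolynomial.X 0) ⊔
      Proj.basicOpen (MvPolynomial.homogeneousSubmodule (Fin 3) F) (MvPolynomial.X 1)).ι ≫
    Proj.toSpecZero (MvPolynomial.homogeneousSubmodule (Fin 3) F) ≫
    Spec.map (CommRingCat.ofHom (algebraMap F (MvPolynomial.homogeneousSubmodule (Fin 3) F 0))))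

/-- **The total record functor** `K ↦ M_K` on the open compact `K ≤ K_f(3)` of `U(V)(𝔸_{F⁺,f})`: the chosen system `(recordOf h V h4).M`
when `4 ≤ [F:ℚ]` (the only case any hComp theorem reads — face guard `6 ≤ [F:ℚ]`), else (imaginary quadratic `F`, `V.Hm` isotropic, no
compact Shimura surface) the constant system at the punctured plane `ℙ²_F ∖ pt` (Noncompact-Case shape, l. 2055–2064; RULING F1′).  The ONE `dite` of
the instance (hcomp-lead S6, placed inside the functor: every field of `honestP5Of` and its slot formula stay uniform in `F`).
[cite: Liu2021, §4.2 l. 2053–2060 and Prop. C.5 l. 4627–4633] [cite: Deligne1979ShimuraVarieties, 2.2.5] -/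
def recordFunctorOf (h : exists_recordSystem) (V : HermSpace3 F ι₁) : C5.SmallLevel (K3 V) ⥤ SchemeOver F :=
  if h4 : 4 ≤ Module.finrank ℚ F then (recordOf h V h4).M else (Functor.const _).obj (puncturedPlane F)

/-- Under `4 ≤ [F:ℚ]` the total record functor IS the chosen system's `M` (`dif_pos`). [cite: Deligne1979ShimuraVarieties, 2.2.5] -/
theorem recordFunctorOf_eq (h : exists_recordSystem) (V : HermSpace3 F ι₁) (h4 : 4 ≤ Module.finrank ℚ F) :
    recordFunctorOf h V = (recordOf h V h4).M :=
  dif_pos h4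

/-- The functor-level identification `recordFunctorOf h V ≅ (recordOf h V h4).M` (an `eqToIso`). [cite: Deligne1979ShimuraVarieties, 2.2.5] -/
def recordFunctorOfIso (h : exists_recordSystem) (V : HermSpace3 F ι₁) (h4 : 4 ≤ Module.finrank ℚ F) :
    recordFunctorOf h V ≅ (recordOf h V h4).M :=
  eqToIso (recordFunctorOf_eq h V h4)

/-- **The consumed rewriting lemma, OBJECT level** (non-dependent: both sides are `F`-schemes): `(recordFunctorOf h V) K ≅ M_K` of the
chosen system, for `4 ≤ [F:ℚ]`. [cite: Deligne1979ShimuraVarieties, 2.2.5] -/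
def recordFunctorOf_objIso (h : exists_recordSystem) (V : HermSpace3 F ι₁) (h4 : 4 ≤ Module.finrank ℚ F)
    (K : C5.SmallLevel (K3 V)) : (recordFunctorOf h V).obj K ≅ (recordOf h V h4).M.obj K :=
  (recordFunctorOfIso h V h4).app K

end RecordFunctor

/-! ## §2  The total honest datum `honestP5Of` and its consumed slot at P2′ -/

section Total

variable (h : exists_recordSystem)

/-- **`Model.honestP5Of h` — the honest Prop-C.5 datum as a TOTAL function of `(F, ι₁, V, Φ)`** (the shape of pin-1's carrier `P5`),
i.e. `honestP5 V (K3 V) (recordFunctorOf h V)` ([Liu2021] App. C l. 4618–4624, Prop. C.5): `n := 3`, `G := Gτ τ := ↥V.adelicFin =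
U(V)(𝔸_{F⁺,f})`, `fix τ := refl`, tokens `𝕍`, `V τ`, and ONE slot formula `Sh τ τ' : K ↦ X_{K ⊓ K_f(3)} ⊗_{F,τ'} τ'(F)`,
`X_K := M_K ⊗_{F,c} F` with `M` the total record functor (§1) — ALL uniform in `F`; the consumed slot `(τ₁, ῑ₁)` is the chosen record's
own complex fibre (`honestP5Of_slotIsoConj`).  CONDITIONAL on the named fact `h`; HC_CM is NOT proved; `Φ` is not read (the datum of
Prop. C.5 does not depend on the CM type). [cite: Liu2021, App. C l. 4618–4624 and Prop. C.5 l. 4627–4633]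
[cite: Deligne1979ShimuraVarieties, 2.2.5 and Cor. 2.7.21] -/
abbrev honestP5Of : ∀ (F : CMField) (ι₁ : F →+* ℂ) (V : HermSpace3 F ι₁) (_ : Literature.AlgebraicGeometry.Motives.CMType F),
    PropC5Data (maximalRealSubfield F) F :=
  fun _ _ V _ => honestP5 V (K3 V) (recordFunctorOf h V)

variable {F : CMField} {ι₁ : F →+* ℂ} (V : HermSpace3 F ι₁) (Φ : Literature.AlgebraicGeometry.Motives.CMType F)

/-- `(honestP5Of h F ι₁ V Φ).G = U(V)(𝔸_{F⁺,f})` by `rfl`, for EVERY `F` (S6: no cast on pin-1's `K`). [cite: Liu2021, App. C l. 4618] -/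
theorem honestP5Of_G : (honestP5Of h F ι₁ V Φ).G = ↥V.adelicFin := rfl

/-- `(honestP5Of h F ι₁ V Φ).fix τ = refl`. [cite: Liu2021, App. C l. 4624] -/
theorem honestP5Of_fix (τ : maximalRealSubfield F →+* ℝ) :
    (honestP5Of h F ι₁ V Φ).fix τ = ContinuousMulEquiv.refl _ := rfl

/-- **The structure-level equation under the guard** (hcomp-lead l.5367, pin-1's option 1): for `4 ≤ [F:ℚ]`,
`honestP5Of h F ι₁ V Φ = honestP5 V (K3 V) (recordOf h V h4).M` — the honest datum of the CHOSEN record system (`congrArg` of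
`recordFunctorOf_eq`; use it with `▸`/`rw` only in non-dependent positions — hcomp-ref R-5 — else use `honestP5Of_slotIsoConj`).
[cite: Liu2021, Prop. C.5 l. 4627–4633] [cite: Deligne1979ShimuraVarieties, 2.2.5] -/
theorem honestP5Of_eq (h4 : 4 ≤ Module.finrank ℚ F) :
    honestP5Of h F ι₁ V Φ = honestP5 V (K3 V) (recordOf h V h4).M :=
  congrArg (honestP5 V (K3 V)) (recordFunctorOf_eq h V h4)

/-- **Prop. C.5 CONSTRUCTED on the total datum**: the system of Shimura varieties `Sh(𝕍)_K := X_K` with its printed isomorphisms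
(`honestSystem` of `HonestP5.lean` at `M := recordFunctorOf h V`; threshold `K₀ := K3 V`). [cite: Liu2021, Prop. C.5 l. 4627–4633 and Def. C.6] -/
abbrev honestSystemOf : IncoherentShimuraSystem (honestP5Of h F ι₁ V Φ) :=
  honestSystem V (K3 V) (recordFunctorOf h V)

/-- **Prop. C.5 holds for `honestP5Of h F ι₁ V Φ`, by construction.** [cite: Liu2021, Prop. C.5 l. 4627–4633] -/
theorem propC5AsPrinted_honestP5Of : PropC5AsPrinted (honestP5Of h F ι₁ V Φ) :=
  propC5AsPrinted_honestP5 V (K3 V) (recordFunctorOf h V)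

/-- `Ksm := K_f(3)` is open compact in `(honestP5Of h F ι₁ V Φ).G` (pin-1's `Ksm` clause; [Liu2021] Prop. C.5 l. 4627–4628 «sufficiently
small», Thm. 4.18 (1) l. 2239). [cite: Liu2021, Prop. C.5 l. 4627–4628 and Thm. 4.18 (1)] -/
theorem honestP5Of_isOpenCompact_K3 : Liu2021.IsOpenCompact ((K3 V).1 : Subgroup (honestP5Of h F ι₁ V Φ).G) := (K3 V).2

/-- **Package P2′, the consumed slot of the TOTAL datum: over `ℂ`, `(honestP5Of h …).Sh τ ῑ₁` at `K ≤ K_f(3)` is the chosen record's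
complex fibre `M_K ⊗_{F,ι₁} ℂ`**, `M_K := (recordOf h V h4).M.obj ⟨K, hK⟩` (`HonestP5.lean` §4 at `M := recordFunctorOf h V`, then the
object-level `recordFunctorOf_objIso`).  pin-1's `e_slot` in row U5. [cite: Liu2021, Prop. C.5 l. 4627–4633 and App. C l. 4583–4596]
[cite: GortzWedhorn2020, Prop. 4.16] [cite: Deligne1979ShimuraVarieties, 2.2.5] -/
def honestP5Of_slotIsoConj (h4 : 4 ≤ Module.finrank ℚ F) (τ : maximalRealSubfield F →+* ℝ)
    (K : C5.OpenCompactSubgroup ↥V.adelicFin) (hK : K ≤ K3 V) :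
    (baseChangeHom ((starRingEnd ℂ).comp ι₁).fieldRange.subtype).obj
        (((honestP5Of h F ι₁ V Φ).Sh τ ((starRingEnd ℂ).comp ι₁)).obj
          (C5.OpenCompactSubgroup.transport ((honestP5Of h F ι₁ V Φ).fix τ) K)) ≅
      (baseChangeHom ι₁).obj ((recordOf h V h4).M.obj ⟨K, hK⟩) :=
  honestP5_Sh_transport_obj_complexIsoConj V (K3 V) (recordFunctorOf h V) τ K hK ≪≫
    (baseChangeHom ι₁).mapIso (recordFunctorOf_objIso h V h4 ⟨K, hK⟩)

/-- **Record cofan ⇒ `hUnif`/`hTree` apex for the TOTAL datum**: a coproduct decomposition `∐_c P_c ≅ M_K ⊗_{F,ι₁} ℂ` of the chosen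
record's complex fibre at `K ≤ K_f(3)` (its `pieces`, [Deligne1979] 2.1.2 on the Baily–Borel algebraisations) is one of the apex
`((honestP5Of h …).Sh τ ῑ₁ (transport (fix τ) K)) ⊗ ℂ` (pin-1's binder at `P5 := honestP5Of h`, `e ι₁ := conj ∘ ι₁`).
[cite: Liu2021, Prop. C.5 l. 4627–4633] [cite: Deligne1979ShimuraVarieties, 2.1.2 and 2.2.5] -/
theorem honestP5Of_exists_isColimit_cofan (h4 : 4 ≤ Module.finrank ℚ F) (τ : maximalRealSubfield F →+* ℝ)
    (K : C5.OpenCompactSubgroup ↥V.adelicFin) (hK : K ≤ K3 V) {Cset : Type} (P : Cset → SchemeOver ℂ)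
    (inj : ∀ c, P c ⟶ (baseChangeHom ι₁).obj ((recordOf h V h4).M.obj ⟨K, hK⟩)) (hcol : IsColimit (Cofan.mk _ inj)) :
    ∃ inj' : ∀ c, P c ⟶ (baseChangeHom ((starRingEnd ℂ).comp ι₁).fieldRange.subtype).obj
        (((honestP5Of h F ι₁ V Φ).Sh τ ((starRingEnd ℂ).comp ι₁)).obj
          (C5.OpenCompactSubgroup.transport ((honestP5Of h F ι₁ V Φ).fix τ) K)),
      Nonempty (IsColimit (Cofan.mk _ inj')) :=
  HComp.exists_isColimit_cofan_of_iso P (honestP5Of_slotIsoConj h V Φ h4 τ K hK).symm inj hcol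

end Total

/-! ## §3  Def. C.8 at a record system, hypothesis-free -/

section Compactified

variable {F : CMField} {ι₁ : F →+* ℂ} (V : HermSpace3 F ι₁) {T : GL (Fin 3) ℂ}
  {hT : formCongr (starRingEnd ℂ) T (V.Hm.map ι₁) = BallModel.J} {K₀ : C5.OpenCompactSubgroup ↥V.adelicFin}
  (S : RecordSystem F V.Hm ι₁ T hT K₀)

/-- **The compactified Shimura varieties (Def. C.8) on `honestSystem V K₀ S.M`, in the Compact Case, HYPOTHESIS-FREE**: the
record's models `M_K` are smooth of relative dimension `2` and projective over `F` (x1's (F1) fields `S.smooth`, `S.projective`;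
`V.Hm` anisotropic), hence so is `Sh(𝕍)_K = X_K = M_K ⊗_{F,c} F` (base change: `smooth_conjSystem_obj`, `projective_conjSystem_obj`), and
[Liu2021] l. 4656 «If `Sh(𝕍)_K` is proper, then `S̃h(𝕍)_K = Sh(𝕍)_K`» makes every compactification map the identity:
`\overline{Sh} := S̃h := X := Sh(𝕍)`, `j = jBar = blowDown := 𝟙`, empty boundary. [cite: Liu2021, App. C l. 4656, Def. C.8 l. 4663–4665, §4.2 l. 2060–2064] -/
def recordCompactified : CompactifiedSystem (honestSystem V K₀ S.M) where
  ShBar K := (conjSystem V K₀ S.M).obj K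
  jBar K := 𝟙 _
  isOpenImmersion_jBar K := by
    change IsOpenImmersion (𝟙 ((conjSystem V K₀ S.M).obj K).left)
    infer_instance
  discrete_boundary K := by
    haveI : Subsingleton
        ↥(Set.range (fun x : ↥((conjSystem V K₀ S.M).obj K).left =>
            (𝟙 ((conjSystem V K₀ S.M).obj K) : _ ⟶ _).left.base x))ᶜ :=
      ⟨fun a _ => (a.2 ⟨a.1, rfl⟩).elim⟩
    infer_instance
  X := conjSystem V K₀ S.M
  blowDown K := 𝟙 _
  j := 𝟙 _
  j_blowDown K := Category.comp_id _
  isOpenImmersion_j K := by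
    change IsOpenImmersion (𝟙 ((conjSystem V K₀ S.M).obj K).left)
    infer_instance
  isIso_j_of_isProper K _ := by
    change IsIso (𝟙 ((conjSystem V K₀ S.M).obj K))
    infer_instance
  smooth_Sh K := smooth_conjSystem_obj V K₀ S.M S.smooth K
  projective_Sh_of _ K := projective_conjSystem_obj V K₀ S.M S.projective K
  smooth_X K := smooth_conjSystem_obj V K₀ S.M S.smooth K
  projective_X K := projective_conjSystem_obj V K₀ S.M S.projective K

end Compactified

end Summit.HodgeConjecture.CorCM.Model
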